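import Summits.Ventures.PercRepro.RankDistCumulative

/-!
# PercRepro — bottom sets under deletion and contraction of a free element (p9, gen 18)

`FreeAt M q e`: `e` is a non-loop and for every `X ⊆ E ∖ e` of rank `≤ q`, `e ∈ cl(E ∖ (X ∪ e))` — no cocircuit
through `e` has rank `≤ q` after removing `e`. For such an element the bottom sets of `(p, q)` (`PerFlat.Uq`,
rank-`q` sets whose complement has rank `p`) split cleanly:
* `mem_Uq_delete_iff` — the bottom sets of `(p, q)` in `M ∖ e` are the bottom sets of `M` avoiding `e`;
* `mem_Uq_contract_iff` — the bottom sets of `(p, q)` in `M / e` are the bottom sets of `(p+1, q+1)` of `M`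
  through `e`, with `e` removed.
The rank bookkeeping: `deleteElem_eRk_eq` (`ρ_{M∖e} = ρ_M` off `e`), `contractElem_eRk_add_one`
(`ρ_{M/e}(X) + 1 = ρ_M(X ∪ e)`), `FreeAt.eRk_diff_eq` (removing `e` from the complement of a rank-`≤ q` set keeps
the rank). `RankDistMinor` turns this into the splitting of the upper shadow and the inheritance of the cumulative
shadow inequality. Nothing here is a statement about any window of the crux.
-/
namespace PercRepro.RankDist

open Set Finset Matroid PercRepro.ThmH

variable {α : Type}

/-- `FreeAt M q e`: `e` is a non-loop and, for every `X ⊆ E ∖ e` of rank `≤ q`, `e ∈ cl(E ∖ (X ∪ e))` —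
no cocircuit through `e` has rank `≤ q` after removing `e`. -/
def FreeAt (M : Matroid α) (q : ℕ) (e : α) : Prop :=
  M.IsNonloop e ∧ ∀ X ⊆ M.E \ {e}, M.eRk X ≤ (q : ℕ∞) → e ∈ M.closure (M.E \ insert e X)

/-- Deleting `e` does not change the rank of a set avoiding `e`. -/
lemma deleteElem_eRk_eq (M : Matroid α) {e : α} {X : Set α} (hX : X ⊆ M.E \ {e}) :
    (M.delete {e}).eRk X = M.eRk X := by
  rw [Matroid.delete_eq_restrict, Matroid.restrict_eRk_eq _ hX]

/-- Contracting a non-loop `e`: `ρ_{M/e}(X) + 1 = ρ_M(X ∪ e)` for `X ⊆ E ∖ e`. -/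
lemma contractElem_eRk_add_one (M : Matroid α) {e : α} (he : M.IsNonloop e) {X : Set α}
    (hX : X ⊆ M.E \ {e}) : (M.contract {e}).eRk X + 1 = M.eRk (insert e X) := by
  have heX : e ∉ X := fun h => (hX h).2 rfl
  obtain ⟨I, hI, heI⟩ := he.indep.subset_isBasis_of_subset
    (Set.singleton_subset_iff.2 (Set.mem_insert e X)) (insert_subset he.mem_ground (hX.trans Set.sdiff_subset))
  have heI' : e ∈ I := Set.singleton_subset_iff.1 heI
  have h2 := hI.contract_isBasis_sdiff_sdiff_of_subset (J := {e}) heI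
  have h3 : insert e X \ {e} = X := by
    rw [insert_sdiff_of_mem _ (mem_singleton e), sdiff_singleton_eq_self heX]
  rw [h3] at h2
  rw [h2.eRk_eq_encard, hI.eRk_eq_encard, encard_sdiff_singleton_add_one heI']

/-- The rank of a set is unchanged by adjoining an element of its closure. -/
lemma eRk_insert_eq_of_mem_closure (M : Matroid α) {e : α} {X : Set α} (he : e ∈ M.closure X) :
    M.eRk (insert e X) = M.eRk X := by
  rw [← M.eRk_closure_eq (insert e X), Matroid.closure_insert_eq_of_mem_closure he, M.eRk_closure_eq]

/-- Under `FreeAt M q e`, removing `e` from the complement of a rank-`≤ q` set avoiding `e` keeps the rank. -/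
lemma FreeAt.eRk_diff_eq (M : Matroid α) {q : ℕ} {e : α} (h : FreeAt M q e) {X : Set α}
    (hX : X ⊆ M.E \ {e}) (hXq : M.eRk X ≤ (q : ℕ∞)) :
    M.eRk (M.E \ insert e X) = M.eRk (M.E \ X) := by
  have hmem := h.2 X hX hXq
  have h1 : M.E \ X = insert e (M.E \ insert e X) := by
    have heE : e ∈ M.E := h.1.mem_ground
    have heX : e ∉ X := fun hh => (hX hh).2 rfl
    ext x
    simp only [Set.mem_sdiff, Set.mem_insert_iff]
    constructor
    · rintro ⟨hxE, hxX⟩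
      by_cases hxe : x = e
      · exact Or.inl hxe
      · exact Or.inr ⟨hxE, fun hh => hh.elim hxe hxX⟩
    · rintro (rfl | ⟨hxE, hx⟩)
      · exact ⟨heE, heX⟩
      · exact ⟨hxE, fun hh => hx (Or.inr hh)⟩
  rw [h1, eRk_insert_eq_of_mem_closure M hmem]

variable [DecidableEq α] (M : Matroid α) [M.Finite]

/-- The ground finset of `M ∖ e`. -/
lemma gr_delete (e : α) : gr (M.delete {e}) = (gr M).erase e := by
  apply Finset.coe_injective
  rw [coe_gr, Finset.coe_erase, coe_gr, Matroid.delete_ground]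

/-- The ground finset of `M / e`. -/
lemma gr_contract (e : α) : gr (M.contract {e}) = (gr M).erase e := by
  apply Finset.coe_injective
  rw [coe_gr, Finset.coe_erase, coe_gr, Matroid.contract_ground]

/-- The bottom sets of `(p, q)` in `M ∖ e` are the bottom sets of `M` avoiding `e` (under `FreeAt M q e`). -/
lemma mem_Uq_delete_iff {p q : ℕ} {e : α} (h : FreeAt M q e) {B : Finset α} :
    B ∈ PerFlat.Uq (M.delete {e}) p q ↔ B ∈ PerFlat.Uq M p q ∧ e ∉ B := by
  rw [PerFlat.mem_Uq, PerFlat.mem_Uq, gr_delete]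
  constructor
  · rintro ⟨hB, hBq, hBp⟩
    have hBe : e ∉ B := fun hh => (Finset.mem_erase.1 (hB hh)).1 rfl
    have hB' : B ⊆ gr M := fun x hx => (Finset.mem_erase.1 (hB hx)).2
    have hBE : (B : Set α) ⊆ M.E \ {e} := by
      rw [← coe_gr, ← Finset.coe_erase]; exact_mod_cast hB
    rw [deleteElem_eRk_eq M hBE] at hBq
    have hcoe : (((gr M).erase e \ B : Finset α) : Set α) = M.E \ insert e (B : Set α) := by
      rw [Finset.coe_sdiff, Finset.coe_erase, coe_gr, Set.sdiff_sdiff, Set.insert_eq]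
    rw [hcoe, deleteElem_eRk_eq M (Set.sdiff_subset_sdiff_right (Set.singleton_subset_iff.2 (Set.mem_insert _ _))),
      h.eRk_diff_eq M hBE (hBq.le)] at hBp
    refine ⟨⟨hB', hBq, ?_⟩, hBe⟩
    rwa [Finset.coe_sdiff, coe_gr]
  · rintro ⟨⟨hB, hBq, hBp⟩, hBe⟩
    have hBE : (B : Set α) ⊆ M.E \ {e} := by
      intro x hx
      exact ⟨by rw [← coe_gr]; exact_mod_cast hB hx, fun hh => hBe (by rw [mem_singleton_iff] at hh; rw [← hh]; exact hx)⟩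
    refine ⟨fun x hx => Finset.mem_erase.2 ⟨fun hh => hBe (hh ▸ hx), hB hx⟩, ?_, ?_⟩
    · rw [deleteElem_eRk_eq M hBE]; exact hBq
    · have hcoe : (((gr M).erase e \ B : Finset α) : Set α) = M.E \ insert e (B : Set α) := by
        rw [Finset.coe_sdiff, Finset.coe_erase, coe_gr, Set.sdiff_sdiff, Set.insert_eq]
      rw [hcoe, deleteElem_eRk_eq M (Set.sdiff_subset_sdiff_right (Set.singleton_subset_iff.2 (Set.mem_insert _ _))),
        h.eRk_diff_eq M hBE (hBq.le)]
      rwa [Finset.coe_sdiff, coe_gr] at hBp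

/-- The bottom sets of `(p, q)` in `M / e` are the bottom sets of `(p+1, q+1)` of `M` through `e`, with `e`
removed (under `FreeAt M (q+1) e`). -/
lemma mem_Uq_contract_iff {p q : ℕ} {e : α} (h : FreeAt M (q + 1) e) {B : Finset α} :
    B ∈ PerFlat.Uq (M.contract {e}) p q ↔ insert e B ∈ PerFlat.Uq M (p + 1) (q + 1) ∧ e ∉ B := by
  rw [PerFlat.mem_Uq, PerFlat.mem_Uq, gr_contract]
  have heE : e ∈ M.E := h.1.mem_ground
  constructor
  · rintro ⟨hB, hBq, hBp⟩
    have hBe : e ∉ B := fun hh => (Finset.mem_erase.1 (hB hh)).1 rfl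
    have hBE : (B : Set α) ⊆ M.E \ {e} := by
      rw [← coe_gr, ← Finset.coe_erase]; exact_mod_cast hB
    have hq := contractElem_eRk_add_one M h.1 hBE
    rw [hBq] at hq
    have hcoe : (((gr M).erase e \ B : Finset α) : Set α) = M.E \ insert e (B : Set α) := by
      rw [Finset.coe_sdiff, Finset.coe_erase, coe_gr, Set.sdiff_sdiff, Set.insert_eq]
    have hp := contractElem_eRk_add_one M h.1 (X := M.E \ insert e (B : Set α))
      (Set.sdiff_subset_sdiff_right (Set.singleton_subset_iff.2 (Set.mem_insert _ _)))
    rw [hcoe] at hBp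
    rw [hBp] at hp
    have hins : insert e (M.E \ insert e (B : Set α)) = M.E \ (B : Set α) := by
      ext x
      simp only [Set.mem_insert_iff, Set.mem_sdiff]
      constructor
      · rintro (rfl | ⟨hxE, hx⟩)
        · exact ⟨heE, hBe⟩
        · exact ⟨hxE, fun hh => hx (Or.inr hh)⟩
      · rintro ⟨hxE, hxB⟩
        by_cases hxe : x = e
        · exact Or.inl hxe
        · exact Or.inr ⟨hxE, fun hh => hh.elim hxe hxB⟩
    rw [hins] at hp
    refine ⟨⟨?_, ?_, ?_⟩, hBe⟩
    · intro x hx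
      rw [Finset.mem_insert] at hx
      rcases hx with rfl | hx
      · rw [← Finset.mem_coe, coe_gr]; exact heE
      · exact (Finset.mem_erase.1 (hB hx)).2
    · rw [Finset.coe_insert]; exact_mod_cast hq.symm
    · rw [Finset.coe_sdiff, coe_gr, Finset.coe_insert]
      rw [h.eRk_diff_eq M hBE ((M.eRk_mono (Set.subset_insert e _)).trans (le_of_eq (by rw [← hq]; push_cast; rfl)))]
      exact_mod_cast hp.symm
  · rintro ⟨⟨hB, hBq, hBp⟩, hBe⟩
    have hBE : (B : Set α) ⊆ M.E \ {e} := by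
      intro x hx
      refine ⟨?_, fun hh => hBe (by rw [mem_singleton_iff] at hh; rw [← hh]; exact hx)⟩
      rw [← coe_gr]; exact_mod_cast hB (Finset.mem_insert_of_mem hx)
    have hq := contractElem_eRk_add_one M h.1 hBE
    rw [Finset.coe_insert] at hBq
    rw [hBq] at hq
    have hq' : (M.contract {e}).eRk (B : Set α) = (q : ℕ∞) := by
      have : (M.contract {e}).eRk (B : Set α) + 1 = (q : ℕ∞) + 1 := by rw [hq]; push_cast; rfl
      exact WithTop.add_right_cancel ENat.one_ne_top this
    refine ⟨fun x hx => Finset.mem_erase.2 ⟨fun hh => hBe (hh ▸ hx), hB (Finset.mem_insert_of_mem hx)⟩, hq', ?_⟩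
    have hcoe : (((gr M).erase e \ B : Finset α) : Set α) = M.E \ insert e (B : Set α) := by
      rw [Finset.coe_sdiff, Finset.coe_erase, coe_gr, Set.sdiff_sdiff, Set.insert_eq]
    have hp := contractElem_eRk_add_one M h.1 (X := M.E \ insert e (B : Set α))
      (Set.sdiff_subset_sdiff_right (Set.singleton_subset_iff.2 (Set.mem_insert _ _)))
    rw [hcoe]
    have hins : insert e (M.E \ insert e (B : Set α)) = M.E \ (B : Set α) := by
      ext x
      simp only [Set.mem_insert_iff, Set.mem_sdiff]
      constructor
      · rintro (rfl | ⟨hxE, hx⟩)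
        · exact ⟨heE, hBe⟩
        · exact ⟨hxE, fun hh => hx (Or.inr hh)⟩
      · rintro ⟨hxE, hxB⟩
        by_cases hxe : x = e
        · exact Or.inl hxe
        · exact Or.inr ⟨hxE, fun hh => hh.elim hxe hxB⟩
    rw [hins] at hp
    rw [Finset.coe_sdiff, coe_gr, Finset.coe_insert] at hBp
    rw [← h.eRk_diff_eq M hBE ((M.eRk_mono (Set.subset_insert e _)).trans hBq.le), hBp] at hp
    have : (M.contract {e}).eRk (M.E \ insert e (B : Set α)) + 1 = (p : ℕ∞) + 1 := by rw [hp]; push_cast; rfl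
    exact WithTop.add_right_cancel ENat.one_ne_top this

end PercRepro.RankDist
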